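/-
Copyright: public-domain mathematics; typed transcription for the H21 Literature library (cell lit-balaban,
Phase-2 proof seat p38 gen 7 = literature-prover-lit-balaban-p38-g7-0).

statement-level skeleton of published theorems with citation tags; proofs where landed; nothing here is a claim about the Yang–Mills mass gap

# Bałaban, *Propagators and renormalization transformations for lattice gauge theories. I*,
# Commun. Math. Phys. **95** (1984) 17–40 — LOCALITY OF THE ENTRIES OF (1.114) ON THE `L²(T_η)` CARRIER OF THE RANDOM
# WALK FOR `G = Δ_a⁻¹` OF RECORD: supports of `J`, `ζ`, `∇`, `∇*` against the cubes `□_z` of the partition `{h_z}`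

[cite: Balaban1984PropagatorsI]  T. Bałaban, Commun. Math. Phys. 95 (1984) 17–40.  p. 35 «for 0 ≤ α < 1, ζ ∈ C₀^∞(Δ̃(y)),
supp J ⊂ Δ̃(y′)» (after (1.111)), «Cubes Δ̃(y) are sums of 2^d unit cubes having the point y as a corner, thus they are cubes of size 2
and with a center at y»; p. 36 (1.118) (h_z(x) = Π_μ h((x_μ − z_μ)/M₀), h ∈ C₀^∞(]−⅔, ⅔[) — display reconstructed from the formula
layer), «cubes □_z of size 2M₀ and with a center at the point z»; p. 38 (1.131): the walk sum ranges over ω = (ω₀, ω₁, …, ω_n) with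
y ∈ □_{ω₀}, y′ ∈ □_{ω_n} (summation constraint of the display, reconstructed from the formula layer); p. 23 (1.31) the forward
difference `∇_ν` (one lattice step).

WHAT THIS MODULE ADDS (SKELETON rows B5.Eq1.114 / B5.Eq1.123–1.125, owner r02; GAPS G-B5-03; target record `B5Local114.Realisation`
for r02's `latticeSettingP12R n M a k`, fields `hJloc` and the locality members of `RightCert` (third) / `LeftCert` (fifth)).
On the graded carrier of `B5WalkCarrierTorus` / `B5WalkEntriesTorus`, with the real torus `TorR M` of `B5WalkTorusGeom` as the
metric space `X` (`site y = sitePt y`, `ctr z` the exact cube centres, fine sites embedded by `ucPt`):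
* §1 SUPPORT PROPAGATION: a matrix element of `re ∇_ν` couples bonds at most one fine step `η = 1/n` apart
  (`distU_le_of_fdiffR_ne_zero`), hence `∇`, `∇*` move supports by `≤ η` and the tables `D₁ m`, `D₂ m` by `≤ 2η`
  (`exists_of_D1v_ne_zero`, `exists_of_D2v_ne_zero`); `vec J` lives over `Δ̃(y′)` when `supp J ⊂ Δ̃(y′)`;
* §2 THE FIELD `hJloc`: `h_z · D₂ m (vec J) = 0` unless `dist(ctr z, y′) ≤ c̄M₀`, for every `c̄ ≥ 11/3`, `M₀ ≥ 1`
  («y′ ∈ □_{z_n}»: radius ⅔M₀ of supp h_z + 2η + 1);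
* §3 THE CUT-OFF LOCALITIES of the certificates: `cut ζ ∘ D₁ m ∘ h_z = 0` and `h_z ∘ cut ζ = 0` unless `dist(y, ctr z) ≤ c̄M₀`
  («y ∈ □_{z₀}»), same `c̄`.

HONEST SCOPE.  Support bookkeeping only (triangle inequalities in the sup metric of the real torus); no estimate of the paper is
proved here.  value = the located leaves `hJloc` + two certificate members of `B5Local114.Realisation` for the torus of record —
NOT summit progress.
-/
import Mathlib
import Literature.MathematicalPhysics.QuantumFieldTheory.Balaban1983to89.B5CombesThomasLattice
import Literature.MathematicalPhysics.QuantumFieldTheory.Balaban1983to89.B5WalkEntriesTorus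

open scoped BigOperators Real Matrix
open Finset Matrix

namespace Literature.MathematicalPhysics.QuantumFieldTheory.Balaban1983to89.B5WalkLocalityTorus

open Literature.MathematicalPhysics.QuantumFieldTheory.Balaban1983to89
open Literature.MathematicalPhysics.QuantumFieldTheory.Balaban1983to89.B5Prop11Plancherel (Tor fine shiftM fdiff unitVec)
open Literature.MathematicalPhysics.QuantumFieldTheory.Balaban1983to89.B5Prop12FieldsLattice (distU distU_self distU_nonneg cubeT cutInL)
open Literature.MathematicalPhysics.QuantumFieldTheory.Balaban1983to89.B5CombesThomasLattice (distU_triangle distU_step_le)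
open Literature.MathematicalPhysics.QuantumFieldTheory.Balaban1983to89.B5CoverP12Lattice (distU_comm)
open Literature.MathematicalPhysics.QuantumFieldTheory.Balaban1983to89.B5Commutator128 (kerOp kerOp_apply)
open Literature.MathematicalPhysics.QuantumFieldTheory.Balaban1983to89.B5TorusPartition (mulOp mulOp_apply mulOp_eq_zero_of_vanish)
open Literature.MathematicalPhysics.QuantumFieldTheory.Balaban1983to89.B5RealFields (fdiffR reM_apply)
open Literature.MathematicalPhysics.QuantumFieldTheory.Balaban1983to89.B5SettingP12Weighted (sqEta)
open Literature.MathematicalPhysics.QuantumFieldTheory.Balaban1983to89.B5SettingP12Real (LocR latticeSettingP12R)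
open Literature.MathematicalPhysics.QuantumFieldTheory.Balaban1983to89.B5WalkTorusGeom (TorR ucPt sitePt Cen ctr dist_ucPt_le_distU
  dist_ucPt_sitePt_le_one)
open Literature.MathematicalPhysics.QuantumFieldTheory.Balaban1983to89.B5WalkPartitionTorus (hz dist_ctr_le_of_hz_ne_zero)
open Literature.MathematicalPhysics.QuantumFieldTheory.Balaban1983to89.B5WalkCarrierTorus (Gr Bnd Idx Vsp sl Hop hcoef)
open Literature.MathematicalPhysics.QuantumFieldTheory.Balaban1983to89.B5WalkEntriesTorus (g0 g1 g2 dK divK gradK divOp gradOp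
  cut place srcF src0 src1 src2 vsrc D1v D2v)

noncomputable section

variable {d : ℕ} {n : ℕ} [NeZero n] {M : Fin d → ℕ} [hM : ∀ μ, NeZero (M μ)]

/-! ## §1 Support propagation of `∇`, `∇*` and of the tables `D₁`, `D₂` -/

section Propagation

/-- a kernel operator's value at `p` is fed only by indices `q` with a non-zero matrix element and a non-zero input.
[cite: Balaban1984PropagatorsI, (1.31) p.23] -/
theorem exists_of_kerOp_ne_zero {K : Idx n M → Idx n M → ℝ} {f : Vsp n M} {p : Idx n M} (h : kerOp K f p ≠ 0) :
    ∃ q, K p q ≠ 0 ∧ f q ≠ 0 := by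
  rw [kerOp_apply] at h
  obtain ⟨q, -, hq⟩ := Finset.exists_ne_zero_of_sum_ne_zero h
  exact ⟨q, (mul_ne_zero_iff.mp hq).1, (mul_ne_zero_iff.mp hq).2⟩

/-- **a matrix element of `re ∇_ν` couples only bonds one fine step apart**: `(∇_ν)_{ij} ≠ 0 ⇒ |x_i − x_j| ≤ η`.
[cite: Balaban1984PropagatorsI, (1.31) p.23 («(∇_ν J)_μ(x) = η⁻¹(J_μ(x + ηe_ν) − J_μ(x))»)] -/
theorem distU_le_of_fdiffR_ne_zero {ν : Fin d} {i j : Bnd n M} (h : fdiffR n M ν i j ≠ 0) : distU n M i.1 j.1 ≤ 1 / n := by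
  by_contra hd
  apply h
  have h1 : j ≠ (i.1 + unitVec (fine n M) ν, i.2) := fun h1 => hd (by rw [h1]; exact distU_step_le n M i.1 ν)
  have h2 : i ≠ j := fun h2 => hd (by rw [← h2, distU_self]; positivity)
  simp [fdiffR, fdiff, shiftM, h1, h2]

/-- the kernel of `∇*` couples only bonds one fine step apart. [cite: Balaban1984PropagatorsI, (1.31) p.23] -/
theorem distU_le_of_divK_ne_zero {p q : Idx n M} (h : divK n M p q ≠ 0) : distU n M p.1.1 q.1.1 ≤ 1 / n := by
  obtain ⟨b, r⟩ := p
  obtain ⟨b', r'⟩ := q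
  rcases r with _ | μ | pp
  · rcases r' with _ | ν | p'
    · exact (h rfl).elim
    · have h' : fdiffR n M ν b' b ≠ 0 := h
      rw [distU_comm]
      exact distU_le_of_fdiffR_ne_zero h'
    · exact (h rfl).elim
  · rcases r' with _ | ν | p'
    · exact (h rfl).elim
    · exact (h rfl).elim
    · have h' : (if p'.1 = μ then fdiffR n M p'.2 b' b else 0) ≠ 0 := h
      by_cases hp : p'.1 = μ
      · rw [if_pos hp] at h'
        rw [distU_comm]
        exact distU_le_of_fdiffR_ne_zero h'
      · rw [if_neg hp] at h'
        exact (h' rfl).elim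
  · have h0 : divK n M (b, Sum.inr (Sum.inr pp)) (b', r') = 0 := B5WalkEntriesTorus.dK_g2 pp r' b b'
    exact (h h0).elim

/-- `∇*` moves supports by at most one fine step. [cite: Balaban1984PropagatorsI, (1.31) p.23] -/
theorem exists_of_divOp_ne_zero {f : Vsp n M} {p : Idx n M} (h : divOp n M f p ≠ 0) :
    ∃ q, f q ≠ 0 ∧ distU n M p.1.1 q.1.1 ≤ 1 / n := by
  obtain ⟨q, hK, hf⟩ := exists_of_kerOp_ne_zero h
  exact ⟨q, hf, distU_le_of_divK_ne_zero hK⟩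

/-- `∇` moves supports by at most one fine step. [cite: Balaban1984PropagatorsI, (1.31) p.23] -/
theorem exists_of_gradOp_ne_zero {f : Vsp n M} {p : Idx n M} (h : gradOp n M f p ≠ 0) :
    ∃ q, f q ≠ 0 ∧ distU n M p.1.1 q.1.1 ≤ 1 / n := by
  obtain ⟨q, hK, hf⟩ := exists_of_kerOp_ne_zero h
  refine ⟨q, hf, ?_⟩
  rw [distU_comm]
  exact distU_le_of_divK_ne_zero hK

/-- two steps. [cite: Balaban1984PropagatorsI, (1.31) p.23] -/
theorem exists_of_two_steps {S T : Module.End ℝ (Vsp n M)}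
    (hS : ∀ {f : Vsp n M} {p : Idx n M}, S f p ≠ 0 → ∃ q, f q ≠ 0 ∧ distU n M p.1.1 q.1.1 ≤ 1 / n)
    (hT : ∀ {f : Vsp n M} {p : Idx n M}, T f p ≠ 0 → ∃ q, f q ≠ 0 ∧ distU n M p.1.1 q.1.1 ≤ 1 / n)
    {f : Vsp n M} {p : Idx n M} (h : (S * T) f p ≠ 0) : ∃ q, f q ≠ 0 ∧ distU n M p.1.1 q.1.1 ≤ 2 / n := by
  rw [Module.End.mul_apply] at h
  obtain ⟨q₁, h₁, d₁⟩ := hS h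
  obtain ⟨q, h₂, d₂⟩ := hT h₁
  refine ⟨q, h₂, ?_⟩
  calc distU n M p.1.1 q.1.1 ≤ distU n M p.1.1 q₁.1.1 + distU n M q₁.1.1 q.1.1 := distU_triangle n M _ _ _
    _ ≤ 1 / n + 1 / n := add_le_add d₁ d₂
    _ = 2 / n := by ring

omit [NeZero n] hM in
/-- zero steps. [cite: Balaban1984PropagatorsI, (1.31) p.23] -/
theorem exists_of_self_ne_zero {f : Vsp n M} {p : Idx n M} (h : f p ≠ 0) : ∃ q, f q ≠ 0 ∧ distU n M p.1.1 q.1.1 ≤ 2 / n :=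
  ⟨p, h, by rw [distU_self]; positivity⟩

omit [NeZero n] hM in
/-- one step is within two. [cite: Balaban1984PropagatorsI, (1.31) p.23] -/
theorem exists_of_one_step {f : Vsp n M} {p : Idx n M} (h : ∃ q, f q ≠ 0 ∧ distU n M p.1.1 q.1.1 ≤ 1 / n) :
    ∃ q, f q ≠ 0 ∧ distU n M p.1.1 q.1.1 ≤ 2 / n := by
  obtain ⟨q, hq, dq⟩ := h
  refine ⟨q, hq, dq.trans ?_⟩
  have : (0 : ℝ) ≤ 1 / n := by positivity
  have e : (2 : ℝ) / n = 1 / n + 1 / n := by ring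
  linarith

/-- **the table `D₂` moves supports by at most `2η`.** [cite: Balaban1984PropagatorsI, (1.31) p.23, Prop. 1.2 (1.114) p.36] -/
theorem exists_of_D2v_ne_zero (m : Fin 6) {f : Vsp n M} {p : Idx n M} (h : D2v n M m f p ≠ 0) :
    ∃ q, f q ≠ 0 ∧ distU n M p.1.1 q.1.1 ≤ 2 / n := by
  rcases m with ⟨_ | _ | _ | _ | _ | _ | j, hj⟩
  · exact exists_of_self_ne_zero h
  · exact exists_of_self_ne_zero h
  · exact exists_of_one_step (exists_of_divOp_ne_zero h)
  · exact exists_of_one_step (exists_of_divOp_ne_zero h)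
  · exact exists_of_self_ne_zero h
  · exact exists_of_two_steps exists_of_divOp_ne_zero exists_of_divOp_ne_zero h
  · exact absurd hj (by omega)

/-- **the table `D₁` moves supports by at most `2η`.** [cite: Balaban1984PropagatorsI, (1.31) p.23, Prop. 1.2 (1.114) p.36] -/
theorem exists_of_D1v_ne_zero (m : Fin 6) {f : Vsp n M} {p : Idx n M} (h : D1v n M m f p ≠ 0) :
    ∃ q, f q ≠ 0 ∧ distU n M p.1.1 q.1.1 ≤ 2 / n := by
  rcases m with ⟨_ | _ | _ | _ | _ | _ | j, hj⟩
  · exact exists_of_self_ne_zero h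
  · exact exists_of_one_step (exists_of_gradOp_ne_zero h)
  · exact exists_of_self_ne_zero h
  · exact exists_of_one_step (exists_of_gradOp_ne_zero h)
  · exact exists_of_two_steps exists_of_gradOp_ne_zero exists_of_gradOp_ne_zero h
  · exact exists_of_self_ne_zero h
  · exact absurd hj (by omega)

variable (a : ℝ) (k : ℕ)

/-- **`vec J` lives over `Δ̃(y′)` when `supp J ⊂ Δ̃(y′)`.** [cite: Balaban1984PropagatorsI, Prop. 1.2 p.35 («supp J ⊂ Δ̃(y′)»)] -/
theorem mem_cubeT_of_vsrc_ne_zero {J : LocR n M} {q : Idx n M} (h : vsrc n M J q ≠ 0) {y' : Tor M}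
    (hJ : (latticeSettingP12R n M a k).suppIn J y') : q.1.1 ∈ cubeT n M y' := by
  have h' : srcF n M J q.2 q.1 ≠ 0 := by
    intro h0
    apply h
    show sqEta n d * srcF n M J q.2 q.1 = 0
    rw [h0, mul_zero]
  obtain ⟨b, r⟩ := q
  cases J with
  | vec J =>
    rcases r with _ | ν | pp
    · exact hJ b (Complex.ofReal_ne_zero.mpr h')
    · exact (h' rfl).elim
    · exact (h' rfl).elim
  | ten J =>
    rcases r with _ | ν | pp
    · exact (h' rfl).elim
    · exact hJ ν b (Complex.ofReal_ne_zero.mpr h')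
    · exact (h' rfl).elim
  | ten2 J =>
    rcases r with _ | ν | pp
    · exact (h' rfl).elim
    · exact (h' rfl).elim
    · exact hJ pp b (Complex.ofReal_ne_zero.mpr h')

end Propagation

/-! ## §2 The field `hJloc`: «y′ ∈ □_{z_n}» -/

section JLoc

variable (a : ℝ) (k : ℕ)

omit [NeZero n] in
/-- `2/n ≤ 2` for `n ≥ 1`. (plumbing) [cite: Balaban1984PropagatorsI, (1.31) p.23] -/
theorem two_div_le_two (hn : 1 ≤ n) : (2 : ℝ) / n ≤ 2 := by
  have : (1 : ℝ) ≤ n := by exact_mod_cast hn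
  rw [div_le_iff₀ (by linarith)]
  nlinarith

/-- **THE FIELD `hJloc` OF `B5Local114.Realisation` FOR THE TORUS OF RECORD**: if `supp J ⊂ Δ̃(y′)` and the centre of `□_z` is farther
than `c̄M₀` from `y′` (`c̄ ≥ 11/3`, `M₀ ≥ 1`), then `h_z · D₂ m (vec J) = 0` — «the term … can be different from 0 only if … y′ ∈ □_{z_n}».
[cite: Balaban1984PropagatorsI, p.38, (1.118) p.36, Prop. 1.2 p.35] -/
theorem hJloc_holds (hn : 1 ≤ n) {M₀ : ℕ} (hM₀ : 1 ≤ M₀) {cbar : ℝ} (hc : 11 / 3 ≤ cbar) (m : Fin 6) (J : LocR n M)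
    (y' : Tor M) (hJ : (latticeSettingP12R n M a k).suppIn J y') (z : Cen M M₀)
    (hfar : ¬ dist (ctr M M₀ z) (sitePt M y') ≤ cbar * M₀) : Hop n M M₀ z (D2v n M m (vsrc n M J)) = 0 := by
  apply mulOp_eq_zero_of_vanish
  intro p hp
  by_contra hne
  apply hfar
  obtain ⟨q, hq, dpq⟩ := exists_of_D2v_ne_zero m hne
  have hcube := mem_cubeT_of_vsrc_ne_zero a k hq hJ
  have d1 : dist (ucPt M n p.1.1) (ctr M M₀ z) ≤ 2 / 3 * M₀ := dist_ctr_le_of_hz_ne_zero M hM₀ hp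
  have d2 : dist (ucPt M n p.1.1) (ucPt M n q.1.1) ≤ 2 :=
    (dist_ucPt_le_distU M n hn _ _).trans (dpq.trans (two_div_le_two hn))
  have d3 : dist (ucPt M n q.1.1) (sitePt M y') ≤ 1 := dist_ucPt_sitePt_le_one M n hn hcube
  have hM1 : (1 : ℝ) ≤ M₀ := by exact_mod_cast hM₀
  rw [dist_comm] at d1
  calc dist (ctr M M₀ z) (sitePt M y')
      ≤ dist (ctr M M₀ z) (ucPt M n p.1.1) + dist (ucPt M n p.1.1) (ucPt M n q.1.1) + dist (ucPt M n q.1.1) (sitePt M y') :=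
        dist_triangle4 _ _ _ _
    _ ≤ 2 / 3 * M₀ + 2 + 1 := by linarith
    _ ≤ cbar * M₀ := by nlinarith

end JLoc

/-! ## §3 The cut-off localities of the certificates: «y ∈ □_{z₀}» -/

section CutLoc

variable (a : ℝ) (k : ℕ)

/-- a point of `Δ̃(y)` carrying `ζ ≠ 0` is within `1` of `y`. [cite: Balaban1984PropagatorsI, p.35 («ζ ∈ C₀^∞(Δ̃(y))»)] -/
theorem dist_sitePt_le_one_of_cut (hn : 1 ≤ n) {ζ : Tor (fine n M) → ℝ} {y : Tor M} (hζ : cutInL n M ζ y) {x : Tor (fine n M)}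
    (hx : ζ x ≠ 0) : dist (ucPt M n x) (sitePt M y) ≤ 1 :=
  dist_ucPt_sitePt_le_one M n hn (hζ x hx)

/-- **RIGHT-CERTIFICATE LOCALITY**: if `supp ζ ⊂ Δ̃(y)` and the centre of `□_z` is farther than `c̄M₀` from `y` (`c̄ ≥ 11/3`, `M₀ ≥ 1`),
then `ζ · D₁ m · h_z = 0` as an operator — «can be different from 0 only if y ∈ □_{z₀}» (third member of `B5Local114.RightCert`).
[cite: Balaban1984PropagatorsI, p.38, (1.125) p.38, (1.118) p.36] -/
theorem cut_D1v_Hop_eq_zero (hn : 1 ≤ n) {M₀ : ℕ} (hM₀ : 1 ≤ M₀) {cbar : ℝ} (hc : 11 / 3 ≤ cbar) (m : Fin 6)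
    (ζ : Tor (fine n M) → ℝ) (y : Tor M) (hζ : (latticeSettingP12R n M a k).cutIn ζ y) (z : Cen M M₀)
    (hfar : ¬ dist (sitePt M y) (ctr M M₀ z) ≤ cbar * M₀) : cut n M ζ * D1v n M m * Hop n M M₀ z = 0 := by
  apply LinearMap.ext
  intro f
  ext p
  rw [Module.End.mul_apply, Module.End.mul_apply, LinearMap.zero_apply, PiLp.zero_apply]
  show ζ p.1.1 * D1v n M m (Hop n M M₀ z f) p = 0
  by_contra hne
  apply hfar
  obtain ⟨hζp, hD⟩ := mul_ne_zero_iff.mp hne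
  obtain ⟨q, hq, dpq⟩ := exists_of_D1v_ne_zero m hD
  have hhq : hz M M₀ z (ucPt M n q.1.1) ≠ 0 := fun h0 => hq (by show hcoef n M M₀ z q * f q = 0; rw [hcoef, h0, zero_mul])
  have d1 : dist (ucPt M n p.1.1) (sitePt M y) ≤ 1 := dist_sitePt_le_one_of_cut hn hζ hζp
  have d2 : dist (ucPt M n p.1.1) (ucPt M n q.1.1) ≤ 2 :=
    (dist_ucPt_le_distU M n hn _ _).trans (dpq.trans (two_div_le_two hn))
  have d3 : dist (ucPt M n q.1.1) (ctr M M₀ z) ≤ 2 / 3 * M₀ := dist_ctr_le_of_hz_ne_zero M hM₀ hhq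
  have hM1 : (1 : ℝ) ≤ M₀ := by exact_mod_cast hM₀
  rw [dist_comm] at d1
  calc dist (sitePt M y) (ctr M M₀ z)
      ≤ dist (sitePt M y) (ucPt M n p.1.1) + dist (ucPt M n p.1.1) (ucPt M n q.1.1) + dist (ucPt M n q.1.1) (ctr M M₀ z) :=
        dist_triangle4 _ _ _ _
    _ ≤ 1 + 2 + 2 / 3 * M₀ := by linarith
    _ ≤ cbar * M₀ := by nlinarith

/-- **LEFT-CERTIFICATE LOCALITY**: under the same hypotheses `h_z · ζ = 0` (fifth member of `B5Local114.LeftCert`).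
[cite: Balaban1984PropagatorsI, p.38–39, (1.118) p.36] -/
theorem Hop_cut_eq_zero (hn : 1 ≤ n) {M₀ : ℕ} (hM₀ : 1 ≤ M₀) {cbar : ℝ} (hc : 11 / 3 ≤ cbar)
    (ζ : Tor (fine n M) → ℝ) (y : Tor M) (hζ : (latticeSettingP12R n M a k).cutIn ζ y) (z : Cen M M₀)
    (hfar : ¬ dist (sitePt M y) (ctr M M₀ z) ≤ cbar * M₀) : Hop n M M₀ z * cut n M ζ = 0 := by
  apply LinearMap.ext
  intro f
  ext p
  rw [Module.End.mul_apply, LinearMap.zero_apply, PiLp.zero_apply]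
  show hcoef n M M₀ z p * (ζ p.1.1 * f p) = 0
  by_contra hne
  apply hfar
  obtain ⟨hhp, h2⟩ := mul_ne_zero_iff.mp hne
  obtain ⟨hζp, -⟩ := mul_ne_zero_iff.mp h2
  have hhp' : hz M M₀ z (ucPt M n p.1.1) ≠ 0 := hhp
  have d1 : dist (ucPt M n p.1.1) (sitePt M y) ≤ 1 := dist_sitePt_le_one_of_cut hn hζ hζp
  have d3 : dist (ucPt M n p.1.1) (ctr M M₀ z) ≤ 2 / 3 * M₀ := dist_ctr_le_of_hz_ne_zero M hM₀ hhp'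
  have hM1 : (1 : ℝ) ≤ M₀ := by exact_mod_cast hM₀
  rw [dist_comm] at d1
  calc dist (sitePt M y) (ctr M M₀ z) ≤ dist (sitePt M y) (ucPt M n p.1.1) + dist (ucPt M n p.1.1) (ctr M M₀ z) :=
        dist_triangle _ _ _
    _ ≤ 1 + 2 / 3 * M₀ := by linarith
    _ ≤ cbar * M₀ := by nlinarith

end CutLoc

end

end Literature.MathematicalPhysics.QuantumFieldTheory.Balaban1983to89.B5WalkLocalityTorus
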